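import Mathlib.RingTheory.Valuation.ValuationRing
import Mathlib.RingTheory.LocalRing.ResidueField.Basic
import Mathlib.FieldTheory.IsAlgClosed.Basic
import Mathlib.RingTheory.Polynomial.Vieta
import Mathlib.Data.NNReal.Basic
import Literature.NumberTheory.EllipticCurves.TorsionCardinality
import Literature.NumberTheory.EllipticCurves.DivisionPolynomialFormalMulProofs
import HarnessLib

/-!
# The kernel of reduction meets `E[ℓ]` in at most `ℓ` points at a place of good ordinary
# reduction of residue characteristic `ℓ` (Serre 1968, IV, A.2.2; Silverman AEC V.3.1, VII.2–3)

`Proofs` file (theorems only, no definitions, no named facts), topic `NumberTheory/EllipticCurves`.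
Setting of `GoodReductionInertia`: a valued field `(L, w)` (`w : Valuation L ℝ≥0`, valuation
ring `𝒪_w = w.integer`, residue field `κ_w = IsLocalRing.ResidueField 𝒪_w`) and a Weierstrass
equation `V/L` with `w`-integral coefficients (Mathlib `WeierstrassCurve.IsIntegral 𝒪_w V`); the
kernel of reduction `E₁` is the set of affine points `(x, y)` with `w x > 1` together with `O`
(Silverman, *AEC*, VII.2).

Serre, *Abelian ℓ-adic representations and elliptic curves* (1968), Ch. IV, Appendix A.2.2, for
a curve with good reduction of **height 1** (ordinary) at a place `v` of residue characteristic
`ℓ`: `V_ℓ(E) ⊇ X = V_ℓ(Ê)`, the `ℓ`-adic Tate space of the formal group, is a *line* (the formal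
group has height `1`), stable under the decomposition group, and inertia acts on `V_ℓ/X`
trivially.  This file proves the elementary counting statement behind "`X` is a line": **at a
place of good ordinary reduction of residue characteristic `ℓ`, a finite subgroup of `E(L)`
contained in `E₁ ∪ {O}` and killed by `ℓᵐ` has at most `ℓᵐ` elements**
(`card_addSubgroup_le_pow_of_hasseCoeff`; `m = 1`: `card_addSubgroup_le_of_hasseCoeff`, cf.
Silverman AEC V.3.1(a): `Ẽ[ℓ] ≅ ℤ/ℓ`, so `E[ℓ] ∩ E₁` has order `ℓ`).  "Ordinary" is expressed as
`w (A_ℓ(V)) = 1` — the Hasse invariant `WeierstrassCurve.hasseCoeff` (Silverman AEC V.4.1(a)) of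
the integral equation is a `w`-unit — for `ℓ` odd, `w ℓ < 1`, `ℓ ≠ 0` in `L`, `L` algebraically
closed.

## The argument (division polynomials and a Newton-polygon count; no formal group at points)

* `card_roots_filter_valuation_le_one` — for `f ∈ 𝒪_w[X]` with nonzero reduction `f̄`, the roots
  of `f` in `L` of valuation `≤ 1` (with multiplicity) number `deg f̄` (induction: such a root
  `a ∈ 𝒪_w` gives `f = (X - a)g`, `f̄ = (X - ā)ḡ`; if there is none, Vieta and the ultrametric
  inequality show `f̄` constant, `natDegree_map_residue_eq_zero_of_forall_one_lt`); hence the roots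
  of valuation `> 1` number `deg f - deg f̄` (`card_roots_filter_one_lt_valuation`).
* For `f = ΨSq_ℓ` (`deg = ℓ² - 1`, Mathlib `natDegree_ΨSq`) the reduction is `ΨSq_ℓ` of the reduced
  curve, of degree `ℓ² - ℓ` when its Hasse invariant is nonzero — the tree's
  `WeierstrassCurve.natDegree_ΨSq_prime_eq` (`DivisionPolynomialFormalMulProofs`, from
  `[ℓ](z) ≡ A_ℓ z^ℓ + ⋯`); so `ΨSq_ℓ` has exactly `ℓ - 1` roots of valuation `> 1`
  (`card_roots_ΨSq_prime_filter_one_lt_valuation`).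
* An affine `n`-torsion point `(x, y)` has `ΨSqₙ(x) = 0` (tree `zsmul_some_eq_zero_iff_eval_ΨSq`,
  AEC Exercise 3.7(f)) and at most two points share `x`; so a finite set of `n`-torsion points in
  `E₁ ∪ {O}` has at most `2r + 1` elements if `ΨSqₙ` has at most `r` big roots
  (`card_le_of_zsmul_eq_zero_of_one_lt_valuation`).
* A finite subgroup `G ⊆ E₁ ∪ {O}` killed by `ℓᵐ`: its `ℓ`-torsion is an `ℓ`-group with at most
  `2(ℓ - 1) + 1 < ℓ²` elements, hence of order `≤ ℓ`, and `ℓG ⊆ G` is killed by `ℓ^{m-1}`;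
  induction gives `#G ≤ ℓᵐ` (`card_addSubgroup_le_pow_of_one_lt_valuation`).

## References

* [SerreAbelianLadic1968] J.-P. Serre, *Abelian ℓ-adic representations and elliptic curves*,
  Benjamin 1968, Ch. IV, A.2.2 (curves with good reduction of height 1).
* [SilvermanAEC2009] J. H. Silverman, *The Arithmetic of Elliptic Curves*, 2nd ed. (2009):
  V.3.1(a), V.4.1(a) (Hasse invariant), VII.2 (`E₁`), VII.3.1, Exercise 3.7(d),(f).

## Design

No definitions; `noncomputable section`; `open scoped Classical NNReal`; value group `ℝ≥0` and
integrality `V.IsIntegral w.integer` exactly as in `GoodReductionInertia`; membership in `E₁` is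
spelled `1 < w x` on affine points; subgroups are `AddSubgroup V.toAffine.Point` with `[Finite G]`.
-/

noncomputable section

open scoped Classical NNReal
open Polynomial

universe u

namespace Literature.NumberTheory.EllipticCurves

variable {L : Type u} [Field L] {w : Valuation L ℝ≥0}

/-! ## Valuation lemmas -/

section ValuationLemmas

/-- A product of elements `> 1` of `ℝ≥0` is `≥ 1`. [folklore] -/
theorem one_le_multiset_prod_of_one_lt {s : Multiset ℝ≥0} (h : ∀ x ∈ s, 1 < x) : 1 ≤ s.prod :=
  Multiset.one_le_prod_of_one_le fun x hx => (h x hx).le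

/-- A nonempty product of elements `> 1` of `ℝ≥0` is `> 1`. [folklore] -/
theorem one_lt_multiset_prod_of_one_lt {s : Multiset ℝ≥0} (hs : s ≠ 0) (h : ∀ x ∈ s, 1 < x) :
    1 < s.prod := by
  induction s using Multiset.induction_on with
  | empty => exact absurd rfl hs
  | cons a t ih =>
    rw [Multiset.prod_cons]
    exact one_lt_mul_of_lt_of_le' (h a (Multiset.mem_cons_self a t))
      (one_le_multiset_prod_of_one_lt fun x hx => h x (Multiset.mem_cons_of_mem hx))

/-- A product of nonzero elements of `ℝ≥0` is nonzero (positive). [folklore] -/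
theorem multiset_prod_pos_of_one_lt {s : Multiset ℝ≥0} (h : ∀ x ∈ s, 1 < x) : 0 < s.prod :=
  lt_of_lt_of_le one_pos (one_le_multiset_prod_of_one_lt h)

variable (w)

/-- Ultrametric inequality for a multiset sum, strict form. [folklore] -/
theorem valuation_multiset_sum_lt (s : Multiset L) {g : ℝ≥0} (hg : g ≠ 0)
    (h : ∀ x ∈ s, w x < g) : w s.sum < g := by
  induction s using Multiset.induction_on with
  | empty => rw [Multiset.sum_zero, map_zero]; exact pos_iff_ne_zero.mpr hg
  | cons a t ih =>
    rw [Multiset.sum_cons]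
    exact Valuation.map_add_lt w (h a (Multiset.mem_cons_self a t))
      (ih fun x hx => h x (Multiset.mem_cons_of_mem hx))

/-- The valuation of a multiset product is the product of the valuations. [folklore] -/
theorem valuation_multiset_prod (s : Multiset L) : w s.prod = (s.map w).prod :=
  map_multiset_prod w s

/-- **Elementary symmetric functions of "big" elements.**  If every element of the multiset `B`
has valuation `> 1`, then for `j < #B` the `j`-th elementary symmetric function has valuation
strictly less than that of the product of all elements (each `j`-fold product misses at least one
factor of valuation `> 1`). [folklore] -/
theorem valuation_esymm_lt_prod {B : Multiset L} (hB : ∀ b ∈ B, 1 < w b) {j : ℕ}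
    (hj : j < Multiset.card B) : w (B.esymm j) < (B.map w).prod := by
  have hprod : (B.map w).prod ≠ 0 :=
    (multiset_prod_pos_of_one_lt (by simpa using hB)).ne'
  unfold Multiset.esymm
  refine valuation_multiset_sum_lt w _ hprod fun x hx => ?_
  obtain ⟨T, hT, rfl⟩ := Multiset.mem_map.mp hx
  obtain ⟨hTB, hTcard⟩ := Multiset.mem_powersetCard.mp hT
  rw [valuation_multiset_prod]
  have hsplit : B.map w = T.map w + (B - T).map w := by
    rw [← Multiset.map_add, add_tsub_cancel_of_le hTB]
  rw [hsplit, Multiset.prod_add]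
  have hT1 : ∀ x ∈ T.map w, 1 < x := by
    intro x hx
    obtain ⟨b, hb, rfl⟩ := Multiset.mem_map.mp hx
    exact hB b (Multiset.mem_of_le hTB hb)
  have hR1 : ∀ x ∈ (B - T).map w, 1 < x := by
    intro x hx
    obtain ⟨b, hb, rfl⟩ := Multiset.mem_map.mp hx
    exact hB b (Multiset.mem_of_le (Multiset.sub_le_self B T) hb)
  have hR0 : (B - T).map w ≠ 0 := by
    intro h0
    have hc := congrArg Multiset.card h0
    rw [Multiset.card_map, Multiset.card_sub hTB, hTcard, Multiset.card_zero] at hc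
    omega
  exact lt_mul_of_one_lt_right (multiset_prod_pos_of_one_lt hT1)
    (one_lt_multiset_prod_of_one_lt hR0 hR1)

end ValuationLemmas

/-! ## Polynomials over the valuation ring: roots of valuation `≤ 1` and the reduction -/

section RootCount

variable (w)

/-- Elements of `𝒪_w` have valuation `≤ 1`. [folklore] -/
theorem valuation_coe_integer_le_one (z : w.integer) : w (z : L) ≤ 1 := z.2

/-- An element of `𝒪_w` reduces to `0` iff its valuation is `< 1`. [folklore] -/
theorem residue_eq_zero_iff_valuation_lt_one (z : w.integer) :
    IsLocalRing.residue w.integer z = 0 ↔ w (z : L) < 1 := by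
  rw [IsLocalRing.residue_eq_zero_iff, IsLocalRing.mem_maximalIdeal, mem_nonunits_iff,
    Valuation.Integer.not_isUnit_iff_valuation_lt_one]

/-- An element of `𝒪_w` has nonzero reduction iff its valuation is `1`. [folklore] -/
theorem residue_ne_zero_iff_valuation_eq_one (z : w.integer) :
    IsLocalRing.residue w.integer z ≠ 0 ↔ w (z : L) = 1 := by
  rw [Ne, residue_eq_zero_iff_valuation_lt_one, not_lt]
  exact ⟨fun h => le_antisymm z.2 h, fun h => h.ge⟩

/-- The base change `𝒪_w[X] → L[X]` preserves the degree. [folklore] -/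
theorem natDegree_map_algebraMap_integer (f : (w.integer)[X]) :
    (f.map (algebraMap w.integer L)).natDegree = f.natDegree :=
  natDegree_map_eq_of_injective Subtype.val_injective f

/-- **All roots big ⇒ constant reduction.**  If every root in `L` (algebraically closed) of a
polynomial `f ∈ 𝒪_w[X]` has valuation `> 1`, then the reduction `f mod 𝔪_w` is a constant: by
Vieta the coefficient of `Xᵏ`, `k ≥ 1`, is the leading coefficient times an elementary symmetric
function of the roots of order `< deg f`, of valuation strictly less than that of the constant
coefficient `≤ 1`. [folklore] -/
theorem natDegree_map_residue_eq_zero_of_forall_one_lt [IsAlgClosed L] (f : (w.integer)[X])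
    (h : ∀ a ∈ (f.map (algebraMap w.integer L)).roots, 1 < w a) :
    (f.map (IsLocalRing.residue w.integer)).natDegree = 0 := by
  rcases eq_or_ne f 0 with rfl | hf0
  · rw [Polynomial.map_zero, natDegree_zero]
  set fL := f.map (algebraMap w.integer L) with hfL
  have hfL0 : fL ≠ 0 := (Polynomial.map_ne_zero_iff Subtype.val_injective).mpr hf0
  have hn : fL.natDegree = f.natDegree := natDegree_map_algebraMap_integer w f
  have hcard : Multiset.card fL.roots = fL.natDegree :=
    (splits_iff_card_roots.mp (IsAlgClosed.splits fL))
  have hlead0 : w fL.leadingCoeff ≠ 0 := by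
    rw [Valuation.ne_zero_iff]; exact leadingCoeff_ne_zero.mpr hfL0
  -- the constant coefficient: `f(0) = lead · ∏ (-r)`
  have hc0 : w (fL.coeff 0) = w fL.leadingCoeff * (fL.roots.map w).prod := by
    have e := C_leadingCoeff_mul_prod_multiset_X_sub_C hcard
    have h0 : fL.coeff 0 = fL.leadingCoeff * (fL.roots.map fun r => -r).prod := by
      conv_lhs => rw [← e]
      rw [coeff_zero_eq_eval_zero, eval_mul, eval_C, eval_multiset_prod, Multiset.map_map]
      congr 2
      refine Multiset.map_congr rfl fun r _ => ?_
      simp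
    rw [h0, map_mul, valuation_multiset_prod, Multiset.map_map]
    congr 2
    refine Multiset.map_congr rfl fun r _ => ?_
    simp
  have hc0le : w (fL.coeff 0) ≤ 1 := by
    rw [hfL, coeff_map]; exact valuation_coe_integer_le_one w _
  -- every higher coefficient reduces to `0`
  refine Nat.eq_zero_of_le_zero (natDegree_le_iff_coeff_eq_zero.mpr fun N hN => ?_)
  rw [coeff_map, residue_eq_zero_iff_valuation_lt_one]
  have hcoe : ((f.coeff N : w.integer) : L) = fL.coeff N := by rw [hfL, coeff_map]; rfl
  rw [hcoe]
  by_cases hNn : fL.natDegree < N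
  · rw [coeff_eq_zero_of_natDegree_lt hNn, map_zero]; exact one_pos
  rw [not_lt] at hNn
  rw [coeff_eq_esymm_roots_of_card hcard hNn, map_mul, map_mul, map_pow, Valuation.map_neg, map_one,
    one_pow, mul_one]
  calc w fL.leadingCoeff * w (fL.roots.esymm (fL.natDegree - N))
      < w fL.leadingCoeff * (fL.roots.map w).prod :=
        mul_lt_mul_of_pos_left (valuation_esymm_lt_prod w h (by rw [hcard]; omega))
          (pos_iff_ne_zero.mpr hlead0)
    _ = w (fL.coeff 0) := hc0.symm
    _ ≤ 1 := hc0le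

/-- **Roots of valuation `≤ 1` and the degree of the reduction** (the first vertex of the Newton
polygon).  For a polynomial `f ∈ 𝒪_w[X]` with nonzero reduction `f̄ ∈ κ_w[X]` over an
algebraically closed valued field `(L, w)`, the number of roots of `f` in `L` of valuation `≤ 1`,
counted with multiplicity, equals `deg f̄`.  Proof by induction on that number: a root `a` with
`w a ≤ 1` lies in `𝒪_w`, `f = (X - a) g` in `𝒪_w[X]` and `f̄ = (X - ā) ḡ`; when no such root is
left, `f̄` is constant (`natDegree_map_residue_eq_zero_of_forall_one_lt`). [folklore] -/
theorem card_roots_filter_valuation_le_one [IsAlgClosed L] (f : (w.integer)[X])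
    (hf : f.map (IsLocalRing.residue w.integer) ≠ 0) :
    Multiset.card ((f.map (algebraMap w.integer L)).roots.filter fun a => w a ≤ 1) =
      (f.map (IsLocalRing.residue w.integer)).natDegree := by
  suffices H : ∀ (k : ℕ) (f : (w.integer)[X]), f.map (IsLocalRing.residue w.integer) ≠ 0 →
      Multiset.card ((f.map (algebraMap w.integer L)).roots.filter fun a => w a ≤ 1) = k →
      (f.map (IsLocalRing.residue w.integer)).natDegree = k from (H _ f hf rfl).symm
  intro k
  induction k with
  | zero =>
    intro f _ hk
    apply natDegree_map_residue_eq_zero_of_forall_one_lt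
    intro a ha
    by_contra hle
    rw [not_lt] at hle
    have hmem : a ∈ (f.map (algebraMap w.integer L)).roots.filter fun a => w a ≤ 1 :=
      Multiset.mem_filter.mpr ⟨ha, hle⟩
    rw [Multiset.card_eq_zero.mp hk] at hmem
    exact Multiset.notMem_zero a hmem
  | succ k ih =>
    intro f hf hk
    set ι := algebraMap w.integer L with hι
    have hinj : Function.Injective ι := Subtype.val_injective
    set fL := f.map ι with hfL
    have hf0 : f ≠ 0 := by rintro rfl; exact hf (Polynomial.map_zero _)
    have hfL0 : fL ≠ 0 := (Polynomial.map_ne_zero_iff hinj).mpr hf0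
    -- a root of valuation `≤ 1`
    obtain ⟨a, ha⟩ : ∃ a, a ∈ (fL.roots.filter fun a => w a ≤ 1) :=
      Multiset.card_pos_iff_exists_mem.mp (by rw [hk]; exact Nat.succ_pos k)
    obtain ⟨har, ha1⟩ := Multiset.mem_filter.mp ha
    have hroot : fL.IsRoot a := (mem_roots hfL0).mp har
    set a' : w.integer := ⟨a, ha1⟩ with ha'
    have hroot' : f.IsRoot a' := by
      have h1 : ι (f.eval a') = 0 := by
        rw [← eval₂_at_apply, ← eval_map]; exact hroot
      exact (injective_iff_map_eq_zero ι).mp hinj _ h1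
    -- divide by `X - a'` in `𝒪_w[X]`
    set g := f /ₘ (X - C a') with hg
    have hfg : (X - C a') * g = f := mul_divByMonic_eq_iff_isRoot.mpr hroot'
    have hgres : g.map (IsLocalRing.residue w.integer) ≠ 0 := by
      intro h0
      apply hf
      rw [← hfg, Polynomial.map_mul, h0, mul_zero]
    have hdeg : (f.map (IsLocalRing.residue w.integer)).natDegree =
        (g.map (IsLocalRing.residue w.integer)).natDegree + 1 := by
      rw [← hfg, Polynomial.map_mul, Polynomial.map_sub, Polynomial.map_X, Polynomial.map_C,
        natDegree_mul (X_sub_C_ne_zero _) hgres, natDegree_X_sub_C, add_comm]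
    -- the roots of `f` are `a` and the roots of `g`
    have hgL0 : g.map ι ≠ 0 := by
      intro h0; apply hfL0; rw [hfL, ← hfg, Polynomial.map_mul, h0, mul_zero]
    have hroots : fL.roots = a ::ₘ (g.map ι).roots := by
      rw [hfL, ← hfg, Polynomial.map_mul, Polynomial.map_sub, Polynomial.map_X, Polynomial.map_C,
        roots_mul (mul_ne_zero (X_sub_C_ne_zero _) hgL0), roots_X_sub_C, Multiset.singleton_add]
      rfl
    have hk' : Multiset.card ((g.map ι).roots.filter fun a => w a ≤ 1) = k := by
      have hk2 := hk
      rw [hroots, Multiset.filter_cons_of_pos (p := fun a => w a ≤ 1) _ ha1, Multiset.card_cons] at hk2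
      omega
    rw [hdeg, ih g hgres hk']

/-- **Roots of valuation `> 1`**: for `f ∈ 𝒪_w[X]` with nonzero reduction over an algebraically
closed valued field, the number of roots of valuation `> 1` (with multiplicity) is
`deg f - deg f̄`. [folklore] -/
theorem card_roots_filter_one_lt_valuation [IsAlgClosed L] (f : (w.integer)[X])
    (hf : f.map (IsLocalRing.residue w.integer) ≠ 0) :
    Multiset.card ((f.map (algebraMap w.integer L)).roots.filter fun a => 1 < w a) =
      f.natDegree - (f.map (IsLocalRing.residue w.integer)).natDegree := by
  have hf0 : f ≠ 0 := by rintro rfl; exact hf (Polynomial.map_zero _)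
  have hfL0 : f.map (algebraMap w.integer L) ≠ 0 :=
    (Polynomial.map_ne_zero_iff Subtype.val_injective).mpr hf0
  have hcard : Multiset.card (f.map (algebraMap w.integer L)).roots = f.natDegree := by
    rw [splits_iff_card_roots.mp (IsAlgClosed.splits _), natDegree_map_algebraMap_integer]
  have hsplit := Multiset.filter_add_not (fun a => w a ≤ 1) (f.map (algebraMap w.integer L)).roots
  have hc := congrArg Multiset.card hsplit
  rw [Multiset.card_add, card_roots_filter_valuation_le_one w f hf, hcard] at hc
  have e : ((f.map (algebraMap w.integer L)).roots.filter fun a => ¬ w a ≤ 1) =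
      (f.map (algebraMap w.integer L)).roots.filter fun a => 1 < w a :=
    Multiset.filter_congr fun a _ => not_le
  rw [e] at hc
  omega

end RootCount

/-! ## Torsion points in the kernel of reduction: counting through the `x`-coordinate -/

section Points

-- `_root_`: the import closure declares `Literature.NumberTheory.EllipticCurves.WeierstrassCurve.*`
open _root_.WeierstrassCurve

variable (w) (V : WeierstrassCurve L)

/-- **Torsion points with big `x`-coordinate.**  Let `n : ℤ` with `ΨSqₙ ≠ 0` and suppose `ΨSqₙ`
has at most `r` roots (with multiplicity) of valuation `> 1`.  Then a finite set of points of
`V(L)` all killed by `n` and whose affine members `(x, y)` all have `w x > 1` (i.e. lie in the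
kernel of reduction `E₁`) has at most `2r + 1` elements: the `x`-coordinate of an affine
`n`-torsion point is a root of `ΨSqₙ` (Silverman AEC Exercise 3.7(f)), and at most two points
share an `x`-coordinate. [Silverman AEC VII.3.1 (method: Exercise 3.7)] [cite: SilvermanAEC2009, VII.3.1] -/
theorem card_le_of_zsmul_eq_zero_of_one_lt_valuation {n : ℤ} {r : ℕ} (hΨ : V.ΨSq n ≠ 0)
    (hroots : Multiset.card ((V.ΨSq n).roots.filter fun a => 1 < w a) ≤ r)
    (s : Finset V.toAffine.Point) (hn : ∀ P ∈ s, n • P = 0)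
    (h1 : ∀ x y h, Affine.Point.some x y h ∈ s → 1 < w x) :
    s.card ≤ 2 * r + 1 := by
  -- remove `O`
  set s' := s.erase 0 with hs'
  have hcard : s.card ≤ s'.card + 1 := by
    by_cases h0 : (0 : V.toAffine.Point) ∈ s
    · rw [hs', Finset.card_erase_add_one h0]
    · rw [hs', Finset.erase_eq_of_notMem h0]; exact Nat.le_succ _
  -- the `x`-coordinate
  let xc : V.toAffine.Point → L := fun P => match P with
    | .zero => 0
    | .some x _ _ => x
  set R : Finset L := ((V.ΨSq n).roots.filter fun a => 1 < w a).toFinset with hR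
  have hRcard : R.card ≤ r := (Multiset.toFinset_card_le _).trans hroots
  have himage : s'.image xc ⊆ R := by
    intro b hb
    obtain ⟨P, hP, rfl⟩ := Finset.mem_image.mp hb
    have hP0 : P ≠ 0 := Finset.ne_of_mem_erase hP
    have hPs : P ∈ s := Finset.mem_of_mem_erase hP
    rcases P with _ | ⟨x, y, h⟩
    · exact absurd rfl hP0
    · rw [hR, Multiset.mem_toFinset, Multiset.mem_filter, mem_roots hΨ]
      exact ⟨(V.zsmul_some_eq_zero_iff_eval_ΨSq h n).mp (hn _ hPs), h1 x y h hPs⟩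
  -- fibres of `xc` on `s'` have at most two elements
  have hfib : ∀ b ∈ s'.image xc, (s'.filter fun P => xc P = b).card ≤ 2 := by
    intro b hb
    obtain ⟨P₀, hP₀, hb₀⟩ := Finset.mem_image.mp hb
    have hP₀0 : P₀ ≠ 0 := Finset.ne_of_mem_erase hP₀
    rcases P₀ with _ | ⟨x₀, y₀, h₀⟩
    · exact absurd rfl hP₀0
    change x₀ = b at hb₀
    subst hb₀
    have hsub : (s'.filter fun P => xc P = x₀) ⊆
        {Affine.Point.some x₀ y₀ h₀, -Affine.Point.some x₀ y₀ h₀} := by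
      intro P hP
      obtain ⟨hPs', hPx⟩ := Finset.mem_filter.mp hP
      have hP0 : P ≠ 0 := Finset.ne_of_mem_erase hPs'
      rcases P with _ | ⟨x, y, h⟩
      · exact absurd rfl hP0
      change x = x₀ at hPx
      subst hPx
      rw [Finset.mem_insert, Finset.mem_singleton, Affine.Point.neg_some]
      rcases (V.equation_iff_eq_or_eq_negY h₀.left y).mp h.left with hy | hy
      · left; simp only [hy]
      · right; simp only [hy]
    exact (Finset.card_le_card hsub).trans Finset.card_le_two
  have hs'card : s'.card ≤ 2 * (s'.image xc).card := Finset.card_le_mul_card_image s' 2 hfib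
  calc s.card ≤ s'.card + 1 := hcard
    _ ≤ 2 * (s'.image xc).card + 1 := by omega
    _ ≤ 2 * R.card + 1 := by gcongr
    _ ≤ 2 * r + 1 := by omega

/-- The same bound for a finite set of points. [cite: SilvermanAEC2009, VII.3.1] -/
theorem ncard_le_of_zsmul_eq_zero_of_one_lt_valuation {n : ℤ} {r : ℕ} (hΨ : V.ΨSq n ≠ 0)
    (hroots : Multiset.card ((V.ΨSq n).roots.filter fun a => 1 < w a) ≤ r)
    (S : Set V.toAffine.Point) (hS : S.Finite) (hn : ∀ P ∈ S, n • P = 0)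
    (h1 : ∀ x y h, Affine.Point.some x y h ∈ S → 1 < w x) :
    S.ncard ≤ 2 * r + 1 := by
  rw [Set.ncard_eq_toFinset_card S hS]
  exact card_le_of_zsmul_eq_zero_of_one_lt_valuation w V hΨ hroots hS.toFinset
    (fun P hP => hn P (hS.mem_toFinset.mp hP)) (fun x y h hP => h1 x y h (hS.mem_toFinset.mp hP))

/-- **A finite subgroup of the kernel of reduction killed by `ℓᵐ` has order `≤ ℓᵐ`**, provided
`ΨSq_ℓ ≠ 0` has at most `r` roots of valuation `> 1` with `2r + 1 < ℓ²` (at a place of good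
ordinary reduction of residue characteristic `ℓ`: `r = ℓ - 1`).  Induction on `m`: the
`ℓ`-torsion of `G` has at most `2r + 1 < ℓ²` elements and is an `ℓ`-group, hence has order
`≤ ℓ`, and `ℓG ≤ G` is killed by `ℓ^{m-1}`. [Serre 1968, IV, A.2.2; Silverman AEC VII.3.1]
[cite: SerreAbelianLadic1968, IV A.2.2] -/
theorem card_addSubgroup_le_pow_of_one_lt_valuation {ℓ : ℕ} [hℓ : Fact ℓ.Prime] {r : ℕ}
    (hΨ : V.ΨSq ℓ ≠ 0) (hroots : Multiset.card ((V.ΨSq ℓ).roots.filter fun a => 1 < w a) ≤ r)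
    (hr : 2 * r + 1 < ℓ ^ 2) (m : ℕ) (G : AddSubgroup V.toAffine.Point) [Finite G]
    (h1 : ∀ x y h, Affine.Point.some x y h ∈ G → 1 < w x)
    (hm : ∀ P ∈ G, ((ℓ ^ m : ℕ) : ℤ) • P = 0) :
    Nat.card G ≤ ℓ ^ m := by
  induction m generalizing G with
  | zero =>
    have hbot : G = ⊥ := by
      rw [AddSubgroup.eq_bot_iff_forall]
      intro P hP
      have := hm P hP
      rwa [pow_zero, Nat.cast_one, one_zsmul] at this
    subst hbot
    rw [pow_zero, AddSubgroup.card_bot]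
  | succ m ih =>
    -- multiplication by `ℓ` on `G`
    set φ : G →+ V.toAffine.Point :=
      AddMonoidHom.mk' (fun P => (ℓ : ℤ) • (P : V.toAffine.Point)) fun a b => by
        rw [AddSubgroup.coe_add, zsmul_add] with hφ
    have hφapply : ∀ P : G, φ P = (ℓ : ℤ) • (P : V.toAffine.Point) := fun P => rfl
    -- the image is a subgroup of `G` killed by `ℓ^m`
    have hrange_le : φ.range ≤ G := by
      rintro Q ⟨P, rfl⟩
      rw [hφapply]
      exact G.zsmul_mem P.2 _
    haveI : Finite φ.range := Finite.of_surjective φ.rangeRestrict φ.rangeRestrict_surjective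
    have hcard_range : Nat.card φ.range ≤ ℓ ^ m := by
      refine ih φ.range (fun x y h hP => h1 x y h (hrange_le hP)) ?_
      rintro Q ⟨P, rfl⟩
      rw [hφapply, ← mul_zsmul, ← Nat.cast_mul, ← pow_succ]
      exact hm P P.2
    -- the kernel has at most `2r + 1 < ℓ²` elements ...
    have hker_le : Nat.card φ.ker ≤ 2 * r + 1 := by
      set S : Set V.toAffine.Point := {P | P ∈ G ∧ (ℓ : ℤ) • P = 0} with hS
      have hSfin : S.Finite :=
        (Set.finite_range ((↑) : G → V.toAffine.Point)).subset fun P hP => ⟨⟨P, hP.1⟩, rfl⟩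
      have hScard : S.ncard ≤ 2 * r + 1 :=
        ncard_le_of_zsmul_eq_zero_of_one_lt_valuation w V hΨ hroots S hSfin (fun P hP => hP.2)
          (fun x y h hP => h1 x y h hP.1)
      haveI : Finite S := hSfin.to_subtype
      rw [← Nat.card_coe_set_eq] at hScard
      refine (Nat.card_le_card_of_injective (fun P : φ.ker =>
        (⟨((P : G) : V.toAffine.Point), (P : G).2, ?_⟩ : S)) ?_).trans hScard
      · have hP := P.2
        rwa [AddMonoidHom.mem_ker, hφapply] at hP
      · intro P Q hPQ
        have := congrArg Subtype.val hPQ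
        exact Subtype.ext (Subtype.ext this)
    -- ... and is an `ℓ`-group, hence has at most `ℓ` elements
    have hker_le' : Nat.card φ.ker ≤ ℓ := by
      have hpg : IsPGroup ℓ (Multiplicative φ.ker) := by
        intro g
        refine ⟨1, ?_⟩
        rw [pow_one, ← ofAdd_toAdd g, ← ofAdd_nsmul, ← ofAdd_zero]
        congr 1
        apply Subtype.ext
        apply Subtype.ext
        have hg := (Multiplicative.toAdd g).2
        rw [AddMonoidHom.mem_ker, hφapply, natCast_zsmul] at hg
        rw [AddSubmonoidClass.coe_nsmul, AddSubmonoidClass.coe_nsmul, ZeroMemClass.coe_zero,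
          ZeroMemClass.coe_zero]
        exact hg
      obtain ⟨a, ha⟩ := hpg.exists_card_eq
      change Nat.card φ.ker = ℓ ^ a at ha
      rw [ha] at hker_le ⊢
      have ha2 : a < 2 := (Nat.pow_lt_pow_iff_right hℓ.out.one_lt).mp (lt_of_le_of_lt hker_le hr)
      calc ℓ ^ a ≤ ℓ ^ 1 := Nat.pow_le_pow_right hℓ.out.pos (by omega)
        _ = ℓ := pow_one ℓ
    -- `#G = #ker · #range`
    have hmul : Nat.card G = Nat.card φ.ker * Nat.card φ.range := by
      rw [AddSubgroup.card_eq_card_quotient_mul_card_addSubgroup φ.ker, mul_comm,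
        Nat.card_congr (QuotientAddGroup.quotientKerEquivRange φ).toEquiv]
    rw [hmul, pow_succ, mul_comm (ℓ ^ m)]
    exact Nat.mul_le_mul hker_le' hcard_range

end Points

/-! ## Good ordinary reduction of residue characteristic `ℓ`: `ΨSq_ℓ` has `ℓ - 1` big roots -/

section Ordinary

-- `_root_`: the import closure declares `Literature.NumberTheory.EllipticCurves.WeierstrassCurve.*`
open _root_.WeierstrassCurve

variable (w) (V : WeierstrassCurve L) [hV : V.IsIntegral w.integer] {ℓ : ℕ} [hℓ : Fact ℓ.Prime]

/-- The residue field of `𝒪_w` has characteristic `ℓ` when `w ℓ < 1`. [folklore] -/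
theorem charP_residueField_of_valuation_natCast_lt_one (hℓw : w ℓ < 1) :
    CharP (IsLocalRing.ResidueField w.integer) ℓ := by
  refine (CharP.charP_iff_prime_eq_zero hℓ.out).mpr ?_
  rw [← map_natCast (IsLocalRing.residue w.integer), residue_eq_zero_iff_valuation_lt_one]
  simpa using hℓw

/-- **At a place of good ordinary reduction of residue characteristic `ℓ` (odd), `ΨSq_ℓ` has exactly
`ℓ - 1` roots of valuation `> 1`, counted with multiplicity.**  Here "ordinary" is
`w (A_ℓ(V)) = 1`: the Hasse invariant of the (integral) equation is a `w`-unit, i.e. the reduced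
curve has nonzero Hasse invariant.  Indeed `deg ΨSq_ℓ = ℓ² - 1` over `L` (`ℓ ≠ 0` in `L`) while
the reduction has degree `ℓ² - ℓ` (`natDegree_ΨSq_prime_eq`, from `[ℓ](z) ≡ A_ℓ z^ℓ + ⋯`), and
the roots of valuation `≤ 1` account for the degree of the reduction
(`card_roots_filter_valuation_le_one`). [Serre 1968, IV, A.2.2; Silverman AEC V.3.1(a), VII.3.1]
[cite: SerreAbelianLadic1968, IV A.2.2] -/
theorem card_roots_ΨSq_prime_filter_one_lt_valuation [IsAlgClosed L] (hℓ2 : ℓ ≠ 2)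
    (hℓw : w ℓ < 1) (hℓL : (ℓ : L) ≠ 0) (hA : w (V.hasseCoeff ℓ) = 1) :
    Multiset.card ((V.ΨSq ℓ).roots.filter fun a => 1 < w a) = ℓ - 1 := by
  obtain ⟨M, hM⟩ := hV.integral
  haveI := charP_residueField_of_valuation_natCast_lt_one w hℓw
  set res := IsLocalRing.residue w.integer with hres
  -- the reduced equation is ordinary
  have hA' : (M.map res).hasseCoeff ℓ ≠ 0 := by
    rw [hres, map_hasseCoeff, residue_ne_zero_iff_valuation_eq_one]
    have e : ((M.hasseCoeff ℓ : w.integer) : L) = V.hasseCoeff ℓ := by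
      rw [hM, baseChange, map_hasseCoeff]; rfl
    rw [e]; exact hA
  -- degrees
  have hres_ne : (M.ΨSq ℓ).map res ≠ 0 := by
    rw [← map_ΨSq]
    exact (M.map res).ΨSq_prime_ne_zero_of_hasseCoeff_ne_zero ℓ hℓ2 hA'
  have hres_deg : ((M.ΨSq ℓ).map res).natDegree = ℓ ^ 2 - ℓ := by
    rw [← map_ΨSq]
    exact (M.map res).natDegree_ΨSq_prime_eq ℓ hℓ2 hA'
  have hVΨ : V.ΨSq ℓ = (M.ΨSq ℓ).map (algebraMap w.integer L) := by
    rw [hM, baseChange, ← map_ΨSq]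
  have hdeg : (M.ΨSq ℓ).natDegree = ℓ ^ 2 - 1 := by
    rw [← natDegree_map_algebraMap_integer w, ← hVΨ]
    have := V.natDegree_ΨSq (n := ℓ) (by exact_mod_cast hℓL)
    rwa [Int.natAbs_natCast] at this
  rw [hVΨ, card_roots_filter_one_lt_valuation w _ hres_ne, hres_deg, hdeg]
  have h1 : 1 ≤ ℓ := hℓ.out.pos
  have h2 : ℓ ≤ ℓ ^ 2 := by rw [sq]; exact Nat.le_mul_of_pos_left ℓ h1
  omega

/-- **The kernel of reduction meets `E[ℓ^∞]` in a group of rank `≤ 1` at a place of good ordinary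
reduction of residue characteristic `ℓ`** (Serre 1968, IV, A.2.2: `T_ℓ(Ê)` has rank `1`, the
formal group having height `1`).  Precisely: over an algebraically closed valued field `(L, w)`
with `w ℓ < 1`, `ℓ ≠ 0` in `L`, `ℓ` odd, for a `w`-integral Weierstrass equation `V` whose Hasse
invariant is a `w`-unit, every finite subgroup `G ≤ V(L)` killed by `ℓᵐ` all of whose affine
points `(x, y)` have `w x > 1` (i.e. contained in the kernel of reduction `E₁ ∪ {O}`) has order
`≤ ℓᵐ`. [Serre 1968, IV, A.2.2; Silverman AEC V.3.1(a), VII.2–3]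
[cite: SerreAbelianLadic1968, IV A.2.2] -/
theorem card_addSubgroup_le_pow_of_hasseCoeff [IsAlgClosed L] (hℓ2 : ℓ ≠ 2) (hℓw : w ℓ < 1)
    (hℓL : (ℓ : L) ≠ 0) (hA : w (V.hasseCoeff ℓ) = 1) (m : ℕ) (G : AddSubgroup V.toAffine.Point)
    [Finite G] (h1 : ∀ x y h, Affine.Point.some x y h ∈ G → 1 < w x)
    (hm : ∀ P ∈ G, ((ℓ ^ m : ℕ) : ℤ) • P = 0) :
    Nat.card G ≤ ℓ ^ m := by
  have hΨ : V.ΨSq ℓ ≠ 0 := V.ΨSq_ne_zero (n := ℓ) (by exact_mod_cast hℓL)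
  refine card_addSubgroup_le_pow_of_one_lt_valuation w V hΨ
    (card_roots_ΨSq_prime_filter_one_lt_valuation w V hℓ2 hℓw hℓL hA).le ?_ m G h1 hm
  have h2 : 2 ≤ ℓ := hℓ.out.two_le
  have : 2 * ℓ ≤ ℓ ^ 2 := by rw [sq]; exact Nat.mul_le_mul_right ℓ h2
  omega

/-- In particular the `ℓ`-torsion of the kernel of reduction has at most `ℓ` points: a finite
subgroup of `V(L)` killed by `ℓ` inside `E₁ ∪ {O}` has order `≤ ℓ` (Silverman AEC V.3.1(a):
`Ẽ[ℓ] ≅ ℤ/ℓ` for an ordinary curve, so `E[ℓ] → Ẽ[ℓ]` has kernel of order `ℓ`).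
[cite: SilvermanAEC2009, V.3.1] -/
theorem card_addSubgroup_le_of_hasseCoeff [IsAlgClosed L] (hℓ2 : ℓ ≠ 2) (hℓw : w ℓ < 1)
    (hℓL : (ℓ : L) ≠ 0) (hA : w (V.hasseCoeff ℓ) = 1) (G : AddSubgroup V.toAffine.Point)
    [Finite G] (h1 : ∀ x y h, Affine.Point.some x y h ∈ G → 1 < w x)
    (hm : ∀ P ∈ G, (ℓ : ℤ) • P = 0) :
    Nat.card G ≤ ℓ := by
  have := card_addSubgroup_le_pow_of_hasseCoeff w V hℓ2 hℓw hℓL hA 1 G h1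
    (fun P hP => by rw [pow_one]; exact hm P hP)
  rwa [pow_one] at this

end Ordinary

end Literature.NumberTheory.EllipticCurves

end
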